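import Mathlib.Topology.MetricSpace.Contracting
import Mathlib.Topology.Instances.Matrix
import Mathlib.Topology.Order.Compact
import Mathlib.LinearAlgebra.Matrix.ToLinearEquiv
import Mathlib.LinearAlgebra.Matrix.Nondegenerate
import Mathlib.Analysis.Normed.Group.Basic
import Mathlib.Analysis.Normed.Field.Basic
import Literature.Analysis.ValidatedNumerics.KrawczykOperator
import HarnessLib

/-!
# The Krawczyk operator test — proof of Neumaier's Theorem 5.1.8

This file discharges the named fact `Literature.Analysis.ValidatedNumerics.KrawczykTest`
(stated in `Literature/Analysis/ValidatedNumerics/KrawczykOperator.lean`) by proving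
`theorem KrawczykTest_holds : KrawczykTest`.

Source: A. Neumaier, *Interval Methods for Systems of Equations*, Encyclopedia of Mathematics and
its Applications 37, Cambridge University Press, 1990, Theorem 5.1.8 (p. 177):

> Let `A ∈ 𝕀ℝⁿˣⁿ` be an interval Lipschitz matrix for `F : D ⊆ ℝⁿ → ℝⁿ` on the box `x ⊆ D`,
> `x̃ ∈ int x`, `C ∈ ℝⁿˣⁿ`, and `K(x, x̃) := x̃ − C F(x̃) − (C A − I)(x − x̃)` (interval evaluation).
> If `∅ ≠ K(x, x̃) ⊆ int x` then (G1) every `Ã ∈ A` is nonsingular, (G2) `F` has exactly one zero in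
> `x`, and (G3) every zero of `F` in `x` lies in `K(x, x̃)`.

## Proof (our formalisation of the published argument, made elementary)

Neumaier derives 5.1.8 from the strong regularity of `A` (his Cor. 4.1.4 / Thm 5.1.6) and an
existence theorem.  We give a self-contained proof with the same content, avoiding Brouwer's
fixed-point theorem (not available in Mathlib) by a weighted sup-norm contraction:

* (S1) for `M ∈ A`, `y ∈ x` the exact range point `x̃ − C F(x̃) − (C M − I)(y − x̃)` lies in the
  interval evaluation `krawczykSet` (`sub_mulVec_mem_krawczykSet`);
* (S2) hence the Newton-like map `P y := y − C F(y)` maps `x` into `K(x, x̃) ⊆ int x`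
  (`newtonMap_mem_krawczykSet`), using the Lipschitz matrix on the pair `(y, x̃)`;
* (S3) evaluating (S1) at the two corners of `x` extremal for row `i` of `E := C M − I` gives the
  strict weighted row bound `Σ_j |E_ij| (u_j − l_j) < u_i − l_i` (`row_sum_lt`);
* (S4) by compactness of the interval matrix the bound is uniform: there is `θ < 1` with
  `Σ_j |(C M − I)_ij| d_j ≤ θ d_i` for all `M ∈ A` (`exists_contraction_const`, `d := u − l`);
* (S5) in the rescaled variables `w_i := y_i / d_i` the map `P` is a `θ`-contraction of the complete
  box for the sup norm, so it has a fixed point `y⋆ ∈ x` (`ContractingWith.exists_fixedPoint'`),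
  i.e. `C F(y⋆) = 0`;
* (S6) a matrix `B` with `Σ_j |(B − I)_ij| d_j < d_i` for all `i` is nonsingular
  (`det_ne_zero_of_row_sum_lt`, weighted strict diagonal dominance); applied to `B = C M` this gives
  (G1) and `det C ≠ 0`, whence `F(y⋆) = 0`;
* (S7) uniqueness: two zeros `z, z'` satisfy `M (z − z') = 0` for some `M ∈ A`, so `z = z'`;
* (S8) (G3) is (S1) with the Lipschitz matrix on the pair `(z, x̃)`.

The helper lemmas (S1)–(S6) are `private` (plumbing of this one proof; only `KrawczykTest_holds` is
exported).  The hypothesis `∃ K, LipschitzOnWith K F D` of `KrawczykTest` (Neumaier's standing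
assumption that `F` is Lipschitz continuous on `D`) is not needed by the argument.

AI-produced formalisation (H21 engines group, seat eng-cap-2, 2026-08-20); it is the kernel
counterpart of the `THEOREMS` line `krawczyk-eigpair` of the engines package `cap.spectral`.
-/

set_option autoImplicit false

noncomputable section

open Set Matrix

namespace Literature.Analysis.ValidatedNumerics

variable {n : ℕ}

/-- Membership in the interior of a box `[l, u] ⊆ ℝⁿ` is strict componentwise inequality.
[folklore] -/
private theorem mem_interior_Icc_iff {l u y : Fin n → ℝ} :
    y ∈ interior (Icc l u) ↔ ∀ i, l i < y i ∧ y i < u i := by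
  rw [← Set.pi_univ_Icc, interior_pi_set Set.finite_univ]
  simp only [interior_Icc, Set.mem_univ_pi, Set.mem_Ioo]

/-- An interval matrix `[A̲, Ā] ⊆ ℝⁿˣⁿ` is compact. [folklore] -/
private theorem isCompact_matrixIcc (Al Au : Matrix (Fin n) (Fin n) ℝ) :
    IsCompact (matrixIcc Al Au) := by
  have h : matrixIcc Al Au =
      Set.pi univ (fun i => Set.pi univ (fun j => Icc (Al i j) (Au i j))) := by
    ext M
    exact ⟨fun hM i _ j _ => hM i j, fun hM i j => hM i (Set.mem_univ i) j (Set.mem_univ j)⟩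
  rw [h]
  exact isCompact_univ_pi fun i => isCompact_univ_pi fun j => isCompact_Icc

/-- (S1) For `M ∈ A` and `y ∈ X` the exact range point `x̃ − C F(x̃) − (C M − I)(y − x̃)` lies in the
interval evaluation `krawczykSet A C F x̃ X`. [folklore] -/
private theorem sub_mulVec_mem_krawczykSet {A : Set (Matrix (Fin n) (Fin n) ℝ)}
    {C M : Matrix (Fin n) (Fin n) ℝ} {F : (Fin n → ℝ) → (Fin n → ℝ)} {xt y : Fin n → ℝ}
    {X : Set (Fin n → ℝ)} (hM : M ∈ A) (hy : y ∈ X) :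
    xt - C *ᵥ F xt - (C * M - 1) *ᵥ (y - xt) ∈ krawczykSet A C F xt X :=
  fun _ => ⟨C * M, fun _ _ => ⟨M, hM, rfl⟩, y, hy, rfl⟩

/-- (S2) If `A` is a Lipschitz set for `F` on `D ⊇ X` and `x̃, y ∈ X`, then the Newton-like image
`y − C F(y)` lies in `krawczykSet A C F x̃ X`: indeed `F(y) = F(x̃) + M (y − x̃)` for some `M ∈ A`,
so `y − C F(y) = x̃ − C F(x̃) − (C M − I)(y − x̃)`. [folklore] -/
private theorem newtonMap_mem_krawczykSet {A : Set (Matrix (Fin n) (Fin n) ℝ)}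
    {C : Matrix (Fin n) (Fin n) ℝ} {F : (Fin n → ℝ) → (Fin n → ℝ)} {D X : Set (Fin n → ℝ)}
    {xt y : Fin n → ℝ}
    (hA : IsLipschitzSetOn A F D) (hXD : X ⊆ D) (hxt : xt ∈ X) (hy : y ∈ X) :
    y - C *ᵥ F y ∈ krawczykSet A C F xt X := by
  obtain ⟨M, hM, hFM⟩ := hA y (hXD hy) xt (hXD hxt)
  have hFy : F y = M *ᵥ (y - xt) + F xt := sub_eq_iff_eq_add.1 hFM
  have h : y - C *ᵥ F y = xt - C *ᵥ F xt - (C * M - 1) *ᵥ (y - xt) := by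
    rw [hFy, Matrix.mulVec_add, Matrix.sub_mulVec, Matrix.one_mulVec, ← Matrix.mulVec_mulVec]
    abel
  rw [h]
  exact sub_mulVec_mem_krawczykSet hM hy

/-- (S3) If the interval evaluation `K(x, x̃)` lies in the interior of the box `x = [l, u]`, then for
every `M ∈ A` and every row `i` of `E := C M − I` one has `Σ_j |E_ij| (u_j − l_j) < u_i − l_i`:
evaluate (S1) at the two corners of `x` which minimise / maximise the `i`-th component.
[folklore] -/
private theorem row_sum_lt {A : Set (Matrix (Fin n) (Fin n) ℝ)} {C M : Matrix (Fin n) (Fin n) ℝ}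
    {F : (Fin n → ℝ) → (Fin n → ℝ)} {xt l u : Fin n → ℝ} (hM : M ∈ A) (hlu : ∀ j, l j ≤ u j)
    (hK : krawczykSet A C F xt (Icc l u) ⊆ interior (Icc l u)) (i : Fin n) :
    ∑ j, |(C * M - 1) i j| * (u j - l j) < u i - l i := by
  classical
  set E := C * M - 1 with hE
  set c := xt - C *ᵥ F xt with hc
  -- the two corners of the box extremal for row `i`
  set ya : Fin n → ℝ := fun j => if 0 ≤ E i j then u j else l j with hya_def
  set yb : Fin n → ℝ := fun j => if 0 ≤ E i j then l j else u j with hyb_def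
  have hya : ya ∈ Icc l u := by
    refine ⟨fun j => ?_, fun j => ?_⟩ <;> simp only [hya_def] <;> split_ifs
    exacts [hlu j, le_rfl, le_rfl, hlu j]
  have hyb : yb ∈ Icc l u := by
    refine ⟨fun j => ?_, fun j => ?_⟩ <;> simp only [hyb_def] <;> split_ifs
    exacts [le_rfl, hlu j, hlu j, le_rfl]
  have ha := (mem_interior_Icc_iff.1 (hK (sub_mulVec_mem_krawczykSet (C := C) (F := F)
    (xt := xt) hM hya))) i
  have hb := (mem_interior_Icc_iff.1 (hK (sub_mulVec_mem_krawczykSet (C := C) (F := F)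
    (xt := xt) hM hyb))) i
  have hcomp : ∀ y : Fin n → ℝ, (c - E *ᵥ (y - xt)) i = c i - ∑ j, E i j * (y j - xt j) := by
    intro y
    simp [Matrix.mulVec, dotProduct]
  rw [← hc, ← hE, hcomp] at ha hb
  have hdiff : (c i - ∑ j, E i j * (yb j - xt j)) - (c i - ∑ j, E i j * (ya j - xt j))
      = ∑ j, |E i j| * (u j - l j) := by
    rw [sub_sub_sub_cancel_left, ← Finset.sum_sub_distrib]
    refine Finset.sum_congr rfl fun j _ => ?_
    simp only [hya_def, hyb_def]
    split_ifs with h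
    · rw [abs_of_nonneg h]; ring
    · rw [abs_of_neg (lt_of_not_ge h)]; ring
  linarith [ha.1, hb.2, hdiff]

/-- (S4) Uniform contraction constant: if `l < u` componentwise and `K(x, x̃) ⊆ int x` for the
interval matrix `A = [A̲, Ā]`, there is `θ ∈ [0, 1)` with
`Σ_j |(C M − I)_ij| (u_j − l_j) ≤ θ (u_i − l_i)` for all `M ∈ A` and all `i` (compactness of `A` and
continuity of the row sums, applied to (S3)).
[folklore] -/
private theorem exists_contraction_const {Al Au C : Matrix (Fin n) (Fin n) ℝ}
    {F : (Fin n → ℝ) → (Fin n → ℝ)} {xt l u : Fin n → ℝ} (hlu : ∀ j, l j < u j)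
    (hK : krawczykSet (matrixIcc Al Au) C F xt (Icc l u) ⊆ interior (Icc l u)) :
    ∃ θ : ℝ, 0 ≤ θ ∧ θ < 1 ∧
      ∀ M ∈ matrixIcc Al Au, ∀ i, ∑ j, |(C * M - 1) i j| * (u j - l j) ≤ θ * (u i - l i) := by
  classical
  rcases isEmpty_or_nonempty (Fin n) with hn | hn
  · exact ⟨0, le_rfl, zero_lt_one, fun M _ i => (IsEmpty.false i).elim⟩
  by_cases hAne : (matrixIcc Al Au).Nonempty
  swap
  · exact ⟨0, le_rfl, zero_lt_one, fun M hM _ => (hAne ⟨M, hM⟩).elim⟩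
  have hd : ∀ i, 0 < u i - l i := fun i => sub_pos.2 (hlu i)
  -- per-row ratio, continuous in `M`
  set ρ : Fin n → Matrix (Fin n) (Fin n) ℝ → ℝ :=
    fun i M => (∑ j, |(C * M - 1) i j| * (u j - l j)) / (u i - l i) with hρ
  have hρcont : ∀ i, Continuous (ρ i) := by
    intro i
    have hEc : Continuous fun M : Matrix (Fin n) (Fin n) ℝ => C * M - 1 :=
      (continuous_const.matrix_mul continuous_id).sub continuous_const
    show Continuous fun M : Matrix (Fin n) (Fin n) ℝ =>
      (∑ j, |(C * M - 1) i j| * (u j - l j)) / (u i - l i)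
    refine Continuous.div_const ?_ _
    exact continuous_finsetSum _ fun j _ => ((hEc.matrix_elem i j).abs).mul continuous_const
  have hmax : ∀ i, ∃ Mi ∈ matrixIcc Al Au, IsMaxOn (ρ i) (matrixIcc Al Au) Mi := fun i =>
    (isCompact_matrixIcc Al Au).exists_isMaxOn hAne (hρcont i).continuousOn
  choose Mx hMxA hMx using hmax
  have hθi_lt : ∀ i, ρ i (Mx i) < 1 := by
    intro i
    show (∑ j, |(C * Mx i - 1) i j| * (u j - l j)) / (u i - l i) < 1
    rw [div_lt_one (hd i)]
    exact row_sum_lt (hMxA i) (fun j => (hlu j).le) hK i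
  have hθi_nn : ∀ i, 0 ≤ ρ i (Mx i) := fun i =>
    div_nonneg (Finset.sum_nonneg fun j _ => mul_nonneg (abs_nonneg _) (hd j).le) (hd i).le
  refine ⟨Finset.univ.sup' Finset.univ_nonempty fun i => ρ i (Mx i), ?_, ?_, ?_⟩
  · obtain ⟨i⟩ := hn
    exact (hθi_nn i).trans (Finset.le_sup' (fun i => ρ i (Mx i)) (Finset.mem_univ i))
  · exact (Finset.sup'_lt_iff _).2 fun i _ => hθi_lt i
  · intro M hM i
    have h1 : ρ i M ≤ ρ i (Mx i) := (isMaxOn_iff.1 (hMx i)) M hM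
    have h2 : ρ i (Mx i) ≤ Finset.univ.sup' Finset.univ_nonempty fun i => ρ i (Mx i) :=
      Finset.le_sup' (fun i => ρ i (Mx i)) (Finset.mem_univ i)
    have h3 : (∑ j, |(C * M - 1) i j| * (u j - l j)) / (u i - l i)
        ≤ Finset.univ.sup' Finset.univ_nonempty fun i => ρ i (Mx i) := h1.trans h2
    rwa [div_le_iff₀ (hd i)] at h3

/-- (S6) **Weighted strict diagonal dominance.** If `d > 0` and `Σ_j |(B − I)_ij| d_j < d_i` for
every row `i`, then `B` is nonsingular: a kernel vector `v ≠ 0` would satisfy `(B − I) v = −v`, and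
at an index maximising `|v_i| / d_i` this contradicts the row bound. [folklore] -/
private theorem det_ne_zero_of_row_sum_lt {B : Matrix (Fin n) (Fin n) ℝ} {d : Fin n → ℝ}
    (hd : ∀ i, 0 < d i) (hrow : ∀ i, ∑ j, |(B - 1) i j| * d j < d i) : B.det ≠ 0 := by
  classical
  intro hdet
  obtain ⟨v, hv0, hBv⟩ := Matrix.exists_mulVec_eq_zero_iff.2 hdet
  rcases isEmpty_or_nonempty (Fin n) with hn | hn
  · exact hv0 (funext fun i => (IsEmpty.false i).elim)
  obtain ⟨i₀, -, hi₀⟩ :=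
    Finset.exists_max_image Finset.univ (fun i => |v i| / d i) Finset.univ_nonempty
  set m := |v i₀| / d i₀ with hm
  have hvle : ∀ j, |v j| ≤ m * d j := fun j => by
    have h := hi₀ j (Finset.mem_univ j)
    rwa [div_le_iff₀ (hd j)] at h
  have hm_pos : 0 < m := by
    by_contra hle
    push Not at hle
    apply hv0
    funext j
    have h1 : |v j| ≤ 0 := by nlinarith [hvle j, hd j, abs_nonneg (v j)]
    exact abs_nonpos_iff.1 h1
  have hEv : (B - 1) *ᵥ v = -v := by
    rw [Matrix.sub_mulVec, hBv, Matrix.one_mulVec, zero_sub]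
  have key : |v i₀| < |v i₀| :=
    calc |v i₀| = |((B - 1) *ᵥ v) i₀| := by rw [hEv, Pi.neg_apply, abs_neg]
      _ = |∑ j, (B - 1) i₀ j * v j| := by simp [Matrix.mulVec, dotProduct]
      _ ≤ ∑ j, |(B - 1) i₀ j * v j| := Finset.abs_sum_le_sum_abs _ _
      _ = ∑ j, |(B - 1) i₀ j| * |v j| := Finset.sum_congr rfl fun j _ => abs_mul _ _
      _ ≤ ∑ j, |(B - 1) i₀ j| * (m * d j) :=
        Finset.sum_le_sum fun j _ => mul_le_mul_of_nonneg_left (hvle j) (abs_nonneg _)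
      _ = m * ∑ j, |(B - 1) i₀ j| * d j := by
        rw [Finset.mul_sum]
        exact Finset.sum_congr rfl fun j _ => by ring
      _ < m * d i₀ := mul_lt_mul_of_pos_left (hrow i₀) hm_pos
      _ = |v i₀| := by rw [hm]; exact div_mul_cancel₀ _ (hd i₀).ne'
  exact lt_irrefl _ key

/-- (S5, estimate) Row bound ⇒ weighted sup-norm bound: if `d > 0` and `Σ_j |E_ij| d_j ≤ θ d_i`
for all `i`, then `|(E (d ⊙ v))_i| / d_i ≤ θ ‖v‖_∞`. [folklore] -/
private theorem abs_mulVec_scaled_div_le {E : Matrix (Fin n) (Fin n) ℝ} {d : Fin n → ℝ} {θ : ℝ}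
    (hd : ∀ i, 0 < d i) (hrow : ∀ i, ∑ j, |E i j| * d j ≤ θ * d i) (v : Fin n → ℝ) (i : Fin n) :
    |(E *ᵥ fun j => d j * v j) i| / d i ≤ θ * ‖v‖ := by
  rw [div_le_iff₀ (hd i)]
  calc |(E *ᵥ fun j => d j * v j) i| = |∑ j, E i j * (d j * v j)| := by
        simp [Matrix.mulVec, dotProduct]
    _ ≤ ∑ j, |E i j * (d j * v j)| := Finset.abs_sum_le_sum_abs _ _
    _ = ∑ j, |E i j| * d j * |v j| := Finset.sum_congr rfl fun j _ => by
        rw [abs_mul, abs_mul, abs_of_pos (hd j), mul_assoc]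
    _ ≤ ∑ j, |E i j| * d j * ‖v‖ := Finset.sum_le_sum fun j _ =>
        mul_le_mul_of_nonneg_left (by simpa [Real.norm_eq_abs] using norm_le_pi_norm v j)
          (mul_nonneg (abs_nonneg _) (hd j).le)
    _ = (∑ j, |E i j| * d j) * ‖v‖ := by rw [Finset.sum_mul]
    _ ≤ θ * d i * ‖v‖ := mul_le_mul_of_nonneg_right (hrow i) (norm_nonneg _)
    _ = θ * ‖v‖ * d i := by ring

/-- **Krawczyk operator test** (Neumaier, *Interval Methods for Systems of Equations*, Thm 5.1.8):
the named fact `KrawczykTest` holds — if `A` is an interval Lipschitz matrix for `F` on the box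
`x = [l, u] ⊆ D`, `x̃ ∈ int x`, and the interval Krawczyk image satisfies `∅ ≠ K(x, x̃) ⊆ int x`, then
every `M ∈ A` is nonsingular, `F` has exactly one zero in `x`, and every zero of `F` in `x` lies in
`K(x, x̃)`.  Proof: steps (S1)–(S8) of the module docstring (weighted sup-norm contraction instead of
Brouwer). [cite: Neumaier1991, Thm 5.1.8] -/
theorem KrawczykTest_holds : KrawczykTest := by
  classical
  intro n F D Al Au C l u xt _hF hA hXD hxt hKne hK
  have hxt' := mem_interior_Icc_iff.1 hxt
  have hlu : ∀ i, l i < u i := fun i => (hxt' i).1.trans (hxt' i).2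
  have hd : ∀ i, 0 < u i - l i := fun i => sub_pos.2 (hlu i)
  have hxtX : xt ∈ Icc l u := interior_subset hxt
  -- (S3) strict row bounds for every `M ∈ A`
  have hrow : ∀ M ∈ matrixIcc Al Au, ∀ i, ∑ j, |(C * M - 1) i j| * (u j - l j) < u i - l i :=
    fun M hM i => row_sum_lt hM (fun j => (hlu j).le) hK i
  -- (S6) ⇒ (G1): every `C M` is nonsingular, hence so are `M` and `C`
  have hCM : ∀ M ∈ matrixIcc Al Au, (C * M).det ≠ 0 := fun M hM =>
    det_ne_zero_of_row_sum_lt hd (hrow M hM)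
  have hreg : ∀ M ∈ matrixIcc Al Au, M.det ≠ 0 := fun M hM h =>
    hCM M hM (by rw [Matrix.det_mul, h, mul_zero])
  have hCdet : C.det ≠ 0 := by
    rcases isEmpty_or_nonempty (Fin n) with hn | ⟨⟨i⟩⟩
    · simp [Matrix.det_isEmpty]
    · obtain ⟨z, hz⟩ := hKne
      obtain ⟨B, hB, -⟩ := hz i
      obtain ⟨M, hM, -⟩ := hB i i
      intro h
      exact hCM M hM (by rw [Matrix.det_mul, h, zero_mul])
  -- (S8) ⇒ (G3): zeros of `F` in `x` lie in `K(x, x̃)`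
  have hG3 : ∀ z ∈ Icc l u, F z = 0 → z ∈ krawczykSet (matrixIcc Al Au) C F xt (Icc l u) := by
    intro z hz hFz
    obtain ⟨M, hM, hFM⟩ := hA z (hXD hz) xt (hXD hxtX)
    have hFxt : F xt = -(M *ᵥ (z - xt)) := by
      rw [hFz, zero_sub] at hFM
      exact neg_eq_iff_eq_neg.1 hFM
    have hz_eq : xt - C *ᵥ F xt - (C * M - 1) *ᵥ (z - xt) = z := by
      rw [hFxt, Matrix.mulVec_neg, Matrix.sub_mulVec, Matrix.one_mulVec, ← Matrix.mulVec_mulVec]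
      abel
    have hmem := sub_mulVec_mem_krawczykSet (C := C) (F := F) (xt := xt) hM hz
    rwa [hz_eq] at hmem
  -- (S4) uniform contraction constant
  obtain ⟨θ, hθ0, hθ1, hθ⟩ := exists_contraction_const (C := C) (F := F) (xt := xt) hlu hK
  -- (S5) the rescaled Newton-like map `Q = S ∘ P ∘ T` on the rescaled box `Xs`
  set d : Fin n → ℝ := fun i => u i - l i with hd_def
  set S : (Fin n → ℝ) → (Fin n → ℝ) := fun y i => y i / d i with hS_def
  set T : (Fin n → ℝ) → (Fin n → ℝ) := fun w i => d i * w i with hT_def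
  set P : (Fin n → ℝ) → (Fin n → ℝ) := fun y => y - C *ᵥ F y with hP_def
  set Q : (Fin n → ℝ) → (Fin n → ℝ) := fun w => S (P (T w)) with hQ_def
  set Xs : Set (Fin n → ℝ) := Icc (S l) (S u) with hXs_def
  have hdi : ∀ i, 0 < d i := hd
  have hTS : ∀ y, T (S y) = y := fun y => funext fun i => by
    simp only [hT_def, hS_def]
    exact mul_div_cancel₀ _ (hdi i).ne'
  have hS_mem : ∀ {y}, y ∈ Icc l u → S y ∈ Xs := fun hy =>
    ⟨fun i => div_le_div_of_nonneg_right (hy.1 i) (hdi i).le,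
     fun i => div_le_div_of_nonneg_right (hy.2 i) (hdi i).le⟩
  have hT_mem : ∀ {w}, w ∈ Xs → T w ∈ Icc l u := fun hw =>
    ⟨fun i => by
      have h := hw.1 i
      simp only [hS_def] at h
      rw [div_le_iff₀ (hdi i)] at h
      simpa [hT_def, mul_comm] using h,
     fun i => by
      have h := hw.2 i
      simp only [hS_def] at h
      rw [le_div_iff₀ (hdi i)] at h
      simpa [hT_def, mul_comm] using h⟩
  have hPX : ∀ {y}, y ∈ Icc l u → P y ∈ Icc l u := fun hy =>
    interior_subset (hK (newtonMap_mem_krawczykSet hA hXD hxtX hy))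
  have hmaps : MapsTo Q Xs Xs := fun w hw => hS_mem (hPX (hT_mem hw))
  -- Lipschitz bound with constant `θ` in the sup norm
  set K : NNReal := ⟨θ, hθ0⟩ with hK_def
  have hlip : LipschitzOnWith K Q Xs := by
    refine LipschitzOnWith.of_dist_le_mul fun w hw w' hw' => ?_
    obtain ⟨M, hM, hFM⟩ := hA (T w) (hXD (hT_mem hw)) (T w') (hXD (hT_mem hw'))
    have hPdiff : P (T w) - P (T w') = -((C * M - 1) *ᵥ (T w - T w')) := by
      simp only [hP_def]
      rw [show T w - C *ᵥ F (T w) - (T w' - C *ᵥ F (T w'))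
            = (T w - T w') - C *ᵥ (F (T w) - F (T w')) by rw [Matrix.mulVec_sub]; abel,
        hFM, Matrix.sub_mulVec, Matrix.one_mulVec, ← Matrix.mulVec_mulVec]
      abel
    have hTdiff : T w - T w' = fun j => d j * (w - w') j := funext fun j => by
      simp [hT_def, mul_sub]
    rw [dist_eq_norm, dist_eq_norm]
    refine (pi_norm_le_iff_of_nonneg (mul_nonneg hθ0 (norm_nonneg _))).2 fun i => ?_
    have hQi : (Q w - Q w') i = -(((C * M - 1) *ᵥ fun j => d j * (w - w') j) i) / d i := by
      have h1 : (Q w - Q w') i = (P (T w) - P (T w')) i / d i := by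
        simp only [hQ_def, hS_def, Pi.sub_apply, sub_div]
      rw [h1, hPdiff, hTdiff, Pi.neg_apply]
    rw [Real.norm_eq_abs, hQi, neg_div, abs_neg, abs_div, abs_of_pos (hdi i)]
    exact abs_mulVec_scaled_div_le hdi (hθ M hM) (w - w') i
  have hK1 : K < 1 := by
    change θ < 1
    exact hθ1
  have hcontr : ContractingWith K (hmaps.restrict Q Xs Xs) :=
    ⟨hK1, (hmaps.lipschitzOnWith_iff_restrict).mp hlip⟩
  have hcomplete : IsComplete Xs := isClosed_Icc.isComplete
  obtain ⟨ws, hws, hfix, -⟩ :=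
    hcontr.exists_fixedPoint' hcomplete hmaps (hS_mem hxtX) (edist_ne_top _ _)
  -- the fixed point is a zero of `F`
  have hysX : T ws ∈ Icc l u := hT_mem hws
  have hPys : P (T ws) = T ws := by
    have h1 : S (P (T ws)) = ws := hfix
    have h2 := congrArg T h1
    rwa [hTS] at h2
  have hFys : F (T ws) = 0 := by
    have hC0 : C *ᵥ F (T ws) = 0 := by
      have h : T ws - C *ᵥ F (T ws) = T ws := hPys
      exact sub_eq_self.1 h
    exact Matrix.eq_zero_of_mulVec_eq_zero hCdet hC0
  -- (S7) uniqueness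
  have huniq : ∀ z ∈ Icc l u, F z = 0 → z = T ws := by
    intro z hz hFz
    obtain ⟨M, hM, hFM⟩ := hA z (hXD hz) (T ws) (hXD hysX)
    rw [hFz, hFys, sub_zero] at hFM
    exact sub_eq_zero.1 (Matrix.eq_zero_of_mulVec_eq_zero (hreg M hM) hFM.symm)
  exact ⟨hreg, ⟨T ws, ⟨hysX, hFys⟩, fun z hz => huniq z hz.1 hz.2⟩, hG3⟩

end Literature.Analysis.ValidatedNumerics

end
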